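import Literature.NumberTheory.EllipticCurves.TianYuanZhang2017.GenusFieldFamily
import Literature.NumberTheory.EllipticCurves.HeathBrown1994.CongruentTwoSelmerMonskyMatrix
import HarnessLib

/-!
# Smith 2016, Theorem 2.2, rows `2` and `3` (with §2, proof of Thm. 1.2): for square-free `n ≡ 2, 3 (mod 8)`, Tian–Yuan–Zhang's genus sum `ℒ_x(n)` is, in `𝔽₂`, the determinant of Monsky's matrix of `n`

Topic `NumberTheory/EllipticCurves`, namespace `Literature.NumberTheory.EllipticCurves.Smith2016`.
Statement-only file: TWO named facts (published theorems — finite identities over `𝔽₂` between Legendre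
symbols and parities of genus class numbers — vendored as `Prop`s, nothing asserted, D-0014), in the tree's
vocabulary (`TianYuanZhang2017.genusSum₁`, `genusClassNumber`, `GenusField`; Monsky's
`HeathBrown1994.monskyMatrixOdd`, `monskyMatrixEven`).  Companion of `CongruentNumberGenusDeterminantRowOne`
(row `1`, Smith's `M₁` written out); consequences in `CongruentNumberGenusDeterminantRowsTwoThreeConsequences`.

## The source, verbatim (held text `paper:arxiv-1603.08479`, chunk p0005)

A. Smith, *The congruent numbers have positive natural density*, arXiv:1603.08479v2 (2016)
[Smith2016CongruentDensity], §2: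
* L34–L44, Definition of `ℒ : ℤ → 𝔽₂` (row `1`); Table 1 (a LaTeX table absent from the held text layer) lists,
  per residue `x` of `n (mod 8)`, an expression `ℒ_x(n)` (second column) and a matrix `M_x` (third column);
  Thm. 2.1 (L48–L55, "[Tian14]" = Tian–Yuan–Zhang Thm. 1.1 for `x ∈ {1,2,3}`): "`ℒ(E⁽ⁿ⁾) ≡ ℒ_x(n) mod 2`",
  i.e. `ℒ_x(n)` IS the genus sum `Σ_{n = d₀d₁⋯d_ℓ, dᵢ ≡ 1 (8), i > 0} ∏ᵢ g(dᵢ) (mod 2)` of [TianYuanZhang2017]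
  Thm. 1.1 — the tree's `genusSum₁ n g` read in `ZMod 2`.
* L59–L61, **Theorem 2.2.** "With `A`, `y`, and `z` defined from `n` as above, the second and third columns of
  Table 1 are equal in the rows corresponding to `n mod 8`."  (Row `x`: `ℒ_x(n) = det M_x`.)
* L65–L75, proof of Thm. 1.2: "Per Monsky's calculations in [Heat94], `rk(Sel⁽²⁾(E⁽ⁿ⁾)) = 2 + crnk(M₁)` for
  `n ≡ 1 (8)`, `rk(Sel⁽²⁾(E⁽ⁿ⁾)) = 2 + crnk(M₂)` for `n ≡ 2 (8)`, and `rk(Sel⁽²⁾(E⁽ⁿ⁾)) = 1 + crnk(M₃[[2r],[2r]])`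
  for `n ≡ 3 (8)` … we see that the column space of `M₃[[2r],[2r]]` is contained in the set of `v` with
  `Σ_{i=1}^r vᵢ = 0`. `y` is not in this space, and similarly `yᵀ` is not in the corresponding row space, so
  `M₃[[2r],[2r]]` has rank two less than `M₃`. This is enough to give the result."

## What is typed, and how (READ THIS)

Monsky's theorem (appendix to [HeathBrown1994SelmerCongruentII], a THEOREM OF THE TREE with equality:
`monsky_card_selmerGroup_two_odd_holds`, `…_even_holds`) says `rk Sel⁽²⁾(E⁽ⁿ⁾) = 2 + s(n)` with
`s(n) = crnk M` for Monsky's matrix `M` of `n` (`monskyMatrixOdd p` for `n = ∏ pᵢ`, `monskyMatrixEven p` for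
`n = 2∏ pᵢ`).  By the sentences L65–L75 just quoted, `crnk M₂ = s(n)` (`n ≡ 2 (8)`) and `crnk M₃ = crnk
M₃[[2r],[2r]] − 1 = s(n)` (`n ≡ 3 (8)`); over `𝔽₂` a square matrix has determinant `1` iff its corank is `0`,
so `det M_x = [s(n) = 0] = det M` in rows `2` and `3`.  The two facts below therefore state Thm. 2.2, rows `2`
and `3`, COMBINED with that printed identification, as `ℒ_x(n) ≡ det M (mod 2)` with MONSKY'S matrix — an
equivalent form that does not require transcribing the (untransmitted) shapes of `M₂`, `M₃`.  Evidence for the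
transcription (not an input): with true class numbers (reduced-form counts), `(genusSum₁ n g mod 2) = det M`
for all square-free `n ≡ 2 (8)`, `n ≤ 6000`, `≤ 3` odd prime factors (364 cases) and all `n ≡ 3 (8)`,
`n ≤ 8000`, `≤ 3` prime factors (382 cases), 0 mismatches (cell `bsd-monsky`, prover-B g17,
`work/smith/check_row2.py`, `check_row3.py`); the same script reproduces row `1` (385 cases).
SOURCE TIER: arXiv preprint, cited as a theorem by Tian, Proc. ICM 2022 [Tian2023CongruentICM] (Thm. 15).
No `_holds` here (programme: HOME/proof/PROOF-B-SMITH22-note.md of cell `bsd-monsky`); `k = 1` is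
discharged in the consequences file.  -- TODO(general form): the bordered rows 5a, 5b, 6, 7a, 7b of Table 1.

## Transcription (tree dictionary)
* `n ≡ 2 (8)` square-free: `n = 2∏ pᵢ` for an injective tuple `p : Fin k → ℕ` of odd primes with
  `(∏ pᵢ) % 4 = 1`; `n ≡ 3 (8)`: `n = ∏ pᵢ` with `(∏ pᵢ) % 8 = 3`.
* `g(d)` = `genusClassNumber (GenusField d)` cast to `ZMod 2`; `ℒ_x(n) = (genusSum₁ n g : ZMod 2)`.
* `det M_x` ↦ `(monskyMatrixEven p).det` resp. `(monskyMatrixOdd p).det` (see above).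

## References
* [Smith2016CongruentDensity] A. Smith, arXiv:1603.08479v2 (2016), §2 (chunk p0005 L34–L75), §2.2 (rows 2, 3:
  chunk p0009 L11–L55, p0010 L1–L23).
* [TianYuanZhang2017] Y. Tian, X. Yuan, S.-W. Zhang, Asian J. Math. 21 (2017), Thm. 1.1, Thm. 1.2.
* [HeathBrown1994SelmerCongruentII] Appendix by P. Monsky, typescript p. 39 L10–L33, p. 41 L20–L36.
* [Tian2023CongruentICM] Y. Tian, Proc. ICM 2022, Thm. 15.
-/

namespace Literature.NumberTheory.EllipticCurves.Smith2016

open Literature.NumberTheory.EllipticCurves.HeathBrown1994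
open Literature.NumberTheory.EllipticCurves.TianYuanZhang2017

/-- **Smith 2016, Theorem 2.2, row `2`** (with §2 L65–L75, verbatim in the module docstring): for
`n = 2p₁⋯p_k ≡ 2 (mod 8)` (distinct odd `pᵢ`, `∏ pᵢ ≡ 1 (mod 4)`), Tian–Yuan–Zhang's genus sum
`ℒ₂(n) = Σ_{n = d₀⋯d_ℓ, dᵢ ≡ 1 (8) (i>0)} ∏ᵢ g(dᵢ)` and the determinant of Monsky's even matrix
`M = (Aᵀ + D₂, D₋₁; D₂, A + D₂)` (same corank as Smith's `M₂`: "`rk Sel⁽²⁾ = 2 + crnk(M₂)` for `n ≡ 2 (8)`")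
agree in `𝔽₂`.  A THEOREM in print, vendored as a named fact.
[cite: Smith2016CongruentDensity, Thm. 2.2 row 2 with §2 proof of Thm. 1.2 (arXiv:1603.08479 chunk p0005 L59–L63, L65–L75)] -/
def smith_thm22_rowTwo : Prop :=
  ∀ (k : ℕ) (p : Fin k → ℕ), (∀ i, (p i).Prime) → (∀ i, Odd (p i)) → Function.Injective p →
    (∏ i, p i) % 4 = 1 →
      ((genusSum₁ (2 * ∏ i, p i) (fun d => genusClassNumber (GenusField d)) : ℕ) : ZMod 2) =
        (monskyMatrixEven p).det

/-- **Smith 2016, Theorem 2.2, row `3`** (with §2 L65–L75, verbatim in the module docstring): for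
`n = p₁⋯p_k ≡ 3 (mod 8)` (distinct odd `pᵢ`), Tian–Yuan–Zhang's genus sum `ℒ₃(n)` and the determinant of
Monsky's odd matrix `M = (A + D₂, D₂; D₂, A + D₋₂)` (same corank as Smith's `M₃`: "`rk Sel⁽²⁾ =
1 + crnk(M₃[[2r],[2r]])`", "`M₃[[2r],[2r]]` has rank two less than `M₃`") agree in `𝔽₂`.  A THEOREM in
print, vendored as a named fact.
[cite: Smith2016CongruentDensity, Thm. 2.2 row 3 with §2 proof of Thm. 1.2 (arXiv:1603.08479 chunk p0005 L59–L63, L65–L75)] -/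
def smith_thm22_rowThree : Prop :=
  ∀ (k : ℕ) (p : Fin k → ℕ), (∀ i, (p i).Prime) → (∀ i, Odd (p i)) → Function.Injective p →
    (∏ i, p i) % 8 = 3 →
      ((genusSum₁ (∏ i, p i) (fun d => genusClassNumber (GenusField d)) : ℕ) : ZMod 2) =
        (monskyMatrixOdd p).det

end Literature.NumberTheory.EllipticCurves.Smith2016
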